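import Summits.Ventures.HodgeRepro2.T5SU11JacobiKPartLaw
import Summits.Ventures.HodgeRepro2.T5SU11JacobiOrbitAngleLaw

/-!
# The joint law of the three polar coordinates (orbit radius, orbit angle, `K`-component) of the explicit model:
radial law ⊗ uniform ⊗ Haar, all three independent

`T5SU11JacobiOrbitAngleLaw` gives the orbit angle `arg(g·0)` uniform on `(−π, π)` and independent of the radius
`|g·0|` under `m_k φ_λ dν / m̂_k(λ)`; `T5SU11JacobiKPartLaw` gives the `K`-component `kProj g` Haar-distributed and
independent of the orbit point. Composing the two product formulas, for measurable `h, ψ : ℝ → ℝ` and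
`Ψ : K → ℝ`:

  **`∫_G h(arg(g·0)) ψ(|g·0|) Ψ(kProj g) m_k φ_λ dν = (∫_{−π}^{π} h) (∫_0^1 r ψ(r) ρ_{k,λ}(r) dr) (∫_K Ψ dk)`**
  (`integral_angle_mul_radial_mul_kProj_eq`), with `ρ_{k,λ}(r) = (1 − r²)^{k/2−2} Φ_λ(−½ log(1 − r²))`,

and on the ray the expectation factorises into the three marginals,

  **`E_{k,λ}[h(arg(g·0)) ψ(|g·0|) Ψ(kProj g)] = E_{k,λ}[h(arg(g·0))] · E_{k,λ}[ψ(|g·0|)] · ∫_K Ψ dk`**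
  (`expectation_angle_mul_radial_mul_kProj_eq`), `E_{k,λ}[h(arg(g·0))] = (1/2π) ∫_{−π}^{π} h`.

The three coordinates `(|g·0|, arg(g·0), kProj g)` determine `g` (`g = s(g·0) · rot(kProj g)`, `T5SU11KProjection`);
the phase `log|a(g)| = −½ log(1 − |g·0|²)` and the Cartan coordinate `t = artanh |g·0|` are functions of the radius.
So this is the joint law of the polar coordinates of the explicit model `π_k⁺ ∗ φ_λ`: the orbit angle and the
`K`-component are uniform, independent of each other and of the radial coordinate, for every weight on the ray
and every real spectral parameter (in the `KAK` decomposition `g = rot v · a_t · rot u'` one has `v² = e^{i arg(g·0)}`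
and `v u' = kProj g`). Nothing is claimed about (N).

Blind lane: Mathlib + the HodgeRepro2 prefix only; no sorry; axioms ⊆ {propext, Classical.choice,
Quot.sound}.
-/

namespace Summit.Ventures.HodgeRepro2.T5SU11JacobiKAKLaw

open MeasureTheory MeasureTheory.Measure Metric Set Filter Topology
open T5SU11Unimodular T5SU11Fibration T5SU11Cartan T5HaarCircle T5BergmanCoefficient
  T5SU11FibrationHaar T5SU11SphericalFunction T5SU11SphericalSymmetry T5SU11SphericalBounds
  T5SU11SphericalContinuous T5SU11JacobiIwasawa T5SU11JacobiTransform T5SU11JacobiWeight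
  T5SU11KFiniteMajorantPow T5SU11OrbitMeasure T5PoincareMeasure T5SU11JacobiLaplacePhase
  T5SU11JacobiOrbitDiscLaw T5SU11JacobiOrbitAngleLaw T5SU11KProjection T5SU11JacobiKPartLaw
open scoped Real

section measure

variable [MeasurableSpace Circle] [BorelSpace Circle]

/-- **THE THREE-FACTOR INTEGRAL FORMULA**: for measurable `h`, `ψ` (of the angle and the radius) and `Ψ` (of the
`K`-component), `∫_G h(arg(g·0)) ψ(|g·0|) Ψ(kProj g) m_k φ_λ dν = (∫_{−π}^{π} h)(∫_0^1 r ψ ρ_{k,λ} dr)(∫_K Ψ dk)`. -/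
theorem integral_angle_mul_radial_mul_kProj_eq {h ψ : ℝ → ℝ} {Ψ : Circle → ℝ} (hh : Measurable h)
    (hψ : Measurable ψ) (hΨ : Measurable Ψ) (k lam : ℝ) :
    ∫ g, h (Complex.arg (orbit g)) * ψ ‖orbit g‖ * ((1 - ‖orbit g‖ ^ 2) ^ (k / 2) * sph lam g) * Ψ (kProj g)
        ∂(nu haarCircle)
      = (∫ θ in Ioo (-π) π, h θ) * (∫ r in Ioo (0 : ℝ) 1,
          r * (ψ r * ((1 - r ^ 2) ^ (k / 2 - 2) * sphPhase lam (-(1 / 2) * Real.log (1 - r ^ 2)))))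
        * ∫ u, Ψ u ∂haarCircle := by
  have hF : Measurable fun z : ℂ => h (Complex.arg z) * ψ ‖z‖ :=
    (hh.comp Complex.measurable_arg).mul (hψ.comp measurable_norm)
  have e := integral_orbit_mul_jacobi_mul_kProj_haar k lam (Φ := fun z => h (Complex.arg z) * ψ ‖z‖) hF hΨ
  rw [e, integral_angle_mul_radial_eq hh hψ k lam]

/-- **THE THREE COORDINATES ARE INDEPENDENT**: on the ray, for measurable `h`, `ψ`, `Ψ`,
`E_{k,λ}[h(arg(g·0)) ψ(|g·0|) Ψ(kProj g)] = E_{k,λ}[h(arg(g·0))] · E_{k,λ}[ψ(|g·0|)] · ∫_K Ψ dk`. -/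
theorem expectation_angle_mul_radial_mul_kProj_eq {h ψ : ℝ → ℝ} {Ψ : Circle → ℝ} (hh : Measurable h)
    (hψ : Measurable ψ) (hΨ : Measurable Ψ) {k lam : ℝ} (hk : 1 < k) (h1 : lam < k) (h2 : 2 < k + lam) :
    (∫ g, h (Complex.arg (orbit g)) * ψ ‖orbit g‖ * Ψ (kProj g) * ((1 - ‖orbit g‖ ^ 2) ^ (k / 2) * sph lam g)
        ∂(nu haarCircle)) / ∫ g, (1 - ‖orbit g‖ ^ 2) ^ (k / 2) * sph lam g ∂(nu haarCircle)
      = ((∫ g, h (Complex.arg (orbit g)) * ((1 - ‖orbit g‖ ^ 2) ^ (k / 2) * sph lam g) ∂(nu haarCircle))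
          / ∫ g, (1 - ‖orbit g‖ ^ 2) ^ (k / 2) * sph lam g ∂(nu haarCircle))
        * ((∫ g, ψ ‖orbit g‖ * ((1 - ‖orbit g‖ ^ 2) ^ (k / 2) * sph lam g) ∂(nu haarCircle))
          / ∫ g, (1 - ‖orbit g‖ ^ 2) ^ (k / 2) * sph lam g ∂(nu haarCircle))
        * ∫ u, Ψ u ∂haarCircle := by
  have hF : Measurable fun z : ℂ => h (Complex.arg z) * ψ ‖z‖ :=
    (hh.comp Complex.measurable_arg).mul (hψ.comp measurable_norm)
  have e := mean_orbit_mul_kProj_eq hk h1 h2 (Φ := fun z => h (Complex.arg z) * ψ ‖z‖) hF hΨ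
  rw [e, expectation_angle_mul_radial_eq hh hψ hk h1 h2]

/-- **The uniform-uniform-radial form**: on the ray,
`E_{k,λ}[h(arg(g·0)) ψ(|g·0|) Ψ(kProj g)] = ((1/2π) ∫_{−π}^{π} h) · E_{k,λ}[ψ(|g·0|)] · ∫_K Ψ dk`. -/
theorem expectation_angle_mul_radial_mul_kProj_eq' {h ψ : ℝ → ℝ} {Ψ : Circle → ℝ} (hh : Measurable h)
    (hψ : Measurable ψ) (hΨ : Measurable Ψ) {k lam : ℝ} (hk : 1 < k) (h1 : lam < k) (h2 : 2 < k + lam) :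
    (∫ g, h (Complex.arg (orbit g)) * ψ ‖orbit g‖ * Ψ (kProj g) * ((1 - ‖orbit g‖ ^ 2) ^ (k / 2) * sph lam g)
        ∂(nu haarCircle)) / ∫ g, (1 - ‖orbit g‖ ^ 2) ^ (k / 2) * sph lam g ∂(nu haarCircle)
      = (∫ θ in Ioo (-π) π, h θ) / (2 * π)
        * ((∫ g, ψ ‖orbit g‖ * ((1 - ‖orbit g‖ ^ 2) ^ (k / 2) * sph lam g) ∂(nu haarCircle))
          / ∫ g, (1 - ‖orbit g‖ ^ 2) ^ (k / 2) * sph lam g ∂(nu haarCircle))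
        * ∫ u, Ψ u ∂haarCircle := by
  rw [expectation_angle_mul_radial_mul_kProj_eq hh hψ hΨ hk h1 h2, expectation_angle_eq hh hk h1 h2]

end measure

end Summit.Ventures.HodgeRepro2.T5SU11JacobiKAKLaw
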